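import Mathlib
import Literature.RepresentationTheory.FiniteGroups.WedderburnBlocks
import Summits.MatrixMultiplication.MatrixMultiplication.Theorems.LevelGradedCohnUmansGradedPricingStubExpansion

/-!
# Graded Plancherel inequality `dim J ≤ Σ_{χ ∈ Irr(G) ∩ J} χ(1)^s` for bi-invariant test spaces
(negative-lemma support for the crux `SubgroupIdentityDesigns`, stmt-MatrixMultiplication-14079)

For a finite group `G`, a BI-INVARIANT subspace `J ≤ ℂ^G` (two-sided translation invariant, as the
test spaces `J` of `GradedDesignFamily` / `GradedPricing` and the level spaces `F_k` of the Lie cruxes)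
and every real exponent `s ≥ 2`:

  `dim J ≤ Σᶠ_{χ ∈ Irr(G) ∩ J} χ(1)^s`   (`finrank_le_gradedBudget`),

i.e. the graded budget of the route `LevelGradedCohnUmans` dominates the dimension of the test space
(the three "walls" `|H_i||H_j| ≤ dim J` and the graded normalizer count of the companion file
`GradedNormalizerCount.lean` are therefore bounds by the budget itself at every exponent `≥ 2`).

Proof: for a Wedderburn isomorphism `φ : ℂ[G] ≃ ∏ ℂ^{dᵢ×dᵢ}` (tree `exists_algEquiv_pi_matrix`) let
`P = {i : χᵢ ∈ J}`; by the `GradedPricing` line's `stub_support` every `f ∈ J` has `φ(f̌)ᵢ = 0` off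
`P`, so by `stub_expansion` `J ≤ RepFun(P)` (BCGPU 2024 `repFun`), of dimension `≤ Σ_{i∈P} dᵢ²`
(`finrank_repFun_le`); the block characters `χᵢ`, `i ∈ P`, are distinct (`character_blockRep_injective`)
members of `Irr(G) ∩ J` of degrees `dᵢ ≥ 1`, and `dᵢ² ≤ dᵢ^s`.  Sorry-free, axioms `propext`,
`Classical.choice`, `Quot.sound`.
-/

set_option linter.dupNamespace false

noncomputable section

open scoped BigOperators Classical
open Module Literature.RepresentationTheory.FiniteGroups

namespace Summit.MatrixMultiplication.MatrixMultiplication.Theorems.SubgroupIdentityDesigns.Negative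

variable {G : Type} [Group G]

/-- The span of the matrix coefficients of a finite family of matrix representations has dimension
at most `Σᵢ nᵢ²`. [folklore] -/
theorem finrank_repFun_le {ι : Type} [Fintype ι] (n : ι → ℕ)
    (ρ : ∀ i, G →* Matrix.GeneralLinearGroup (Fin (n i)) ℂ) :
    Module.finrank ℂ (Literature.Computability.AlgebraicComplexity.repFun n ρ) ≤ ∑ i, n i ^ 2 := by
  classical
  let v : (Σ i : ι, Fin (n i) × Fin (n i)) → (G → ℂ) := fun t g =>
    ((ρ t.1 g : Matrix (Fin (n t.1)) (Fin (n t.1)) ℂ) t.2.1 t.2.2)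
  have hset : {φ : G → ℂ | ∃ (i : ι) (a b : Fin (n i)),
      φ = fun g => ((ρ i g : Matrix (Fin (n i)) (Fin (n i)) ℂ) a b)} = Set.range v := by
    ext φ
    constructor
    · rintro ⟨i, a, b, rfl⟩
      exact ⟨⟨i, a, b⟩, rfl⟩
    · rintro ⟨⟨i, a, b⟩, rfl⟩
      exact ⟨i, a, b, rfl⟩
  have h := finrank_range_le_card (R := ℂ) v
  rw [Fintype.card_sigma] at h
  simp only [Fintype.card_prod, Fintype.card_fin] at h
  unfold Literature.Computability.AlgebraicComplexity.repFun
  rw [hset]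
  simpa [Set.finrank, sq] using h

/-- **Graded Plancherel inequality.**  For a finite group `G`, a BI-INVARIANT subspace `J ≤ ℂ^G`
and a real exponent `s ≥ 2`: `dim J ≤ Σᶠ_{χ ∈ Irr(G) ∩ J} χ(1)^s`.  Proof: for a Wedderburn
isomorphism `φ : ℂ[G] ≃ ∏ ℂ^{dᵢ×dᵢ}` let `P = {i : χᵢ ∈ J}`; by `stub_support` every `f ∈ J` has
`φ(f̌)ᵢ = 0` off `P`, so by `stub_expansion` `J ≤ RepFun(P)`, of dimension `≤ Σ_{i∈P} dᵢ²`; the block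
characters `χᵢ`, `i ∈ P`, are distinct members of `Irr(G) ∩ J` of degrees `dᵢ ≥ 1`, and
`dᵢ² ≤ dᵢ^s`. -/
theorem finrank_le_gradedBudget [Finite G] (J : Submodule ℂ (G → ℂ))
    (hJ : ∀ f ∈ J, ∀ a b : G, (fun g : G => f (a * g * b)) ∈ J) {s : ℝ} (hs : 2 ≤ s) :
    (Module.finrank ℂ J : ℝ) ≤ ∑ᶠ χ ∈ irrChars G ∩ (J : Set (G → ℂ)), (χ 1).re ^ s := by
  classical
  haveI : Fintype G := Fintype.ofFinite G
  obtain ⟨r, d, hd, ⟨φ⟩⟩ := exists_algEquiv_pi_matrix G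
  haveI := hd
  -- the Fourier support of `J`
  let P : Fin r → Prop := fun i => (blockRep φ i).character ∈ J
  -- `J ≤ RepFun(P)`
  have hle : J ≤ Literature.Computability.AlgebraicComplexity.repFun
      (fun i : {i : Fin r // P i} => d i.1)
      (fun i => ((((Pi.evalAlgHom ℂ (fun j : Fin r => Matrix (Fin (d j)) (Fin (d j)) ℂ) i.1).comp
        φ.toAlgHom).toMonoidHom).comp (MonoidAlgebra.of ℂ G)).toHomUnits) := by
    intro f hf
    refine Summit.MatrixMultiplication.MatrixMultiplication.Theorems.GradedPricing.stub_expansion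
      φ P f fun i hi => ?_
    by_contra hne
    exact hi (Summit.MatrixMultiplication.MatrixMultiplication.Theorems.GradedPricing.stub_support
      φ J hJ hf hne)
  have h1 : Module.finrank ℂ J ≤ ∑ i : {i : Fin r // P i}, d i.1 ^ 2 :=
    (Submodule.finrank_mono hle).trans (finrank_repFun_le _ _)
  -- the block characters in `J` are distinct irreducible characters of degree `dᵢ`
  have hfin : (irrChars G ∩ (J : Set (G → ℂ))).Finite :=
    (irrChars_finite_holds G).subset Set.inter_subset_left
  set χ : {i : Fin r // P i} → (G → ℂ) := fun i => (blockRep φ i.1).character with hχ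
  have hinj : Function.Injective χ := fun i j h =>
    Subtype.ext (character_blockRep_injective φ h)
  have hmem : ∀ i, χ i ∈ irrChars G ∩ (J : Set (G → ℂ)) := fun i =>
    ⟨⟨Fin (d i.1) → ℂ, inferInstance, inferInstance, inferInstance, blockRep φ i.1,
      isIrreducible_blockRep φ i.1, rfl⟩, i.2⟩
  have hdeg : ∀ i, ((χ i 1).re : ℝ) = d i.1 := fun i => by
    simp [hχ, Representation.char_one]
  have h2 : ∀ i : {i : Fin r // P i}, ((d i.1 : ℕ) : ℝ) ^ 2 ≤ (d i.1 : ℝ) ^ s := by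
    intro i
    have hd1 : (1 : ℝ) ≤ d i.1 := by exact_mod_cast NeZero.one_le
    calc ((d i.1 : ℕ) : ℝ) ^ 2 = (d i.1 : ℝ) ^ (2 : ℝ) := by norm_cast
      _ ≤ (d i.1 : ℝ) ^ s := Real.rpow_le_rpow_of_exponent_le hd1 hs
  have h3 : ∑ i : {i : Fin r // P i}, (d i.1 : ℝ) ^ s =
      ∑ ψ ∈ Finset.univ.image χ, (ψ 1).re ^ s := by
    rw [Finset.sum_image fun i _ j _ h => hinj h]
    exact Finset.sum_congr rfl fun i _ => by rw [hdeg]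
  calc (Module.finrank ℂ J : ℝ) ≤ ((∑ i : {i : Fin r // P i}, d i.1 ^ 2 : ℕ) : ℝ) := by
        exact_mod_cast h1
    _ = ∑ i : {i : Fin r // P i}, ((d i.1 : ℕ) : ℝ) ^ 2 := by push_cast; rfl
    _ ≤ ∑ i : {i : Fin r // P i}, (d i.1 : ℝ) ^ s := Finset.sum_le_sum fun i _ => h2 i
    _ = ∑ ψ ∈ Finset.univ.image χ, (ψ 1).re ^ s := h3
    _ ≤ ∑ ψ ∈ hfin.toFinset, (ψ 1).re ^ s := by
        refine Finset.sum_le_sum_of_subset_of_nonneg ?_ fun ψ hψ _ => ?_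
        · intro ψ hψ
          rw [Finset.mem_image] at hψ
          obtain ⟨i, _, rfl⟩ := hψ
          exact hfin.mem_toFinset.2 (hmem i)
        · obtain ⟨n, -, hn⟩ := IsIrrChar.exists_apply_one (hfin.mem_toFinset.1 hψ).1
          rw [hn]
          exact Real.rpow_nonneg (by simp) _
    _ = ∑ᶠ χ ∈ irrChars G ∩ (J : Set (G → ℂ)), (χ 1).re ^ s :=
        (finsum_mem_eq_finite_toFinset_sum _ hfin).symm

end Summit.MatrixMultiplication.MatrixMultiplication.Theorems.SubgroupIdentityDesigns.Negative

end
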